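import Summits.KontsevichZagierPeriods.KontsevichZagierPeriods.Theorems.SoloInformedCornerChart
import Summits.KontsevichZagierPeriods.KontsevichZagierPeriods.Theorems.SoloInformedSpecialSet
import HarnessLib

/-!
# The global step: presentability of `P/D` on a plane domain with finite special set

Solo programme `solo-KontsevichZagierPeriods-informed`, session s111, kernel project PRES-RAT(2),
step (δ-3).  **GLOBAL THEOREM** (`soloInformed_presOn_global`): let `K ⊆ ℚ̄ ∩ ℝ` be real-root
closed, `Ω ⊆ ℝ²` open and `ℚ`-semialgebraic with `closure Ω ⊆ (0,1)²`, `F, D ∈ K[x, y]` with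
`frontier Ω ⊆ Z(F)`, `Sing F` finite and the special set `Σ(F, D, Ω)` finite.  Then for every
`P ∈ K[x, y]` the function `P/D` is presentable on `Ω`: every integral representation
`(Ω, ρ)` with `ρ = P/D` on `Ω` (absolutely convergent, as all representations are) is
equivalent under the Kontsevich–Zagier rules to a combination of `d`-dimensional volumes of
`ℚ`-semialgebraic sets.

Proof: presentability is local on the compact square (Lebesgue number, THEOREM LOC); away from
`Σ` a small grid cell is a leaf (THEOREM LEAF); at a point `p ∈ Σ` — which has coordinates in
`K` — a grid cell containing `p` is split at the lines `x = p₀`, `y = p₁` into at most four open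
boxes with vertex `p` (plus a null set), each decided by THEOREM QUADRANT.

References: Kontsevich–Zagier, *Periods* (2001), §1.2.
-/

noncomputable section

open scoped BigOperators Topology
open MeasureTheory Set Filter Metric
open Literature.NumberTheory.Transcendental Literature.NumberTheory.Transcendental.KZ
open Literature.ModelTheory.ExponentialFields (IsSemialgebraic)

namespace Summit.KontsevichZagierPeriods.KontsevichZagierPeriods.Theorems

variable {K : Type*} [Field K] [Algebra K ℝ]

/-! ### Open boxes with endpoints in `K` -/

/-- The open box `∏ᵢ (lo_i, hi_i)` with endpoints in `K`. [this work] -/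
def soloInformedBoxK (lo hi : Fin 2 → K) : Set (Fin 2 → ℝ) :=
  {w | ∀ i, algebraMap K ℝ (lo i) < w i ∧ w i < algebraMap K ℝ (hi i)}

/-- Membership in the box. -/
theorem soloInformed_mem_boxK (lo hi : Fin 2 → K) (w : Fin 2 → ℝ) :
    w ∈ soloInformedBoxK lo hi ↔ ∀ i, algebraMap K ℝ (lo i) < w i ∧ w i < algebraMap K ℝ (hi i) :=
  Iff.rfl

/-- A half-space `{w | lo < w_i}` with `lo ∈ K` is `ℚ`-semialgebraic. -/
theorem soloInformed_isSemialgebraic_gt_coordK (hK : ∀ c : K, IsAlgebraic ℚ (algebraMap K ℝ c))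
    (i : Fin 2) (a : K) : IsSemialgebraic ℚ {w : Fin 2 → ℝ | algebraMap K ℝ a < w i} := by
  have hu : IsSemialgebraic ℚ (univ : Set (Fin 2 → ℝ)) :=
    Literature.ModelTheory.ExponentialFields.isSemialgebraic_univ
  convert (soloInformed_isSemialgebraicFunOn_aevalK hK hu
    (MvPolynomial.C a - MvPolynomial.X i : MvPolynomial (Fin 2) K)).isSemialgebraic_sep_neg using 1
  ext w
  simp [sub_neg]

/-- A half-space `{w | w_i < hi}` with `hi ∈ K` is `ℚ`-semialgebraic. -/
theorem soloInformed_isSemialgebraic_lt_coordK (hK : ∀ c : K, IsAlgebraic ℚ (algebraMap K ℝ c))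
    (i : Fin 2) (a : K) : IsSemialgebraic ℚ {w : Fin 2 → ℝ | w i < algebraMap K ℝ a} := by
  have hu : IsSemialgebraic ℚ (univ : Set (Fin 2 → ℝ)) :=
    Literature.ModelTheory.ExponentialFields.isSemialgebraic_univ
  convert (soloInformed_isSemialgebraicFunOn_aevalK hK hu
    (MvPolynomial.X i - MvPolynomial.C a : MvPolynomial (Fin 2) K)).isSemialgebraic_sep_neg using 1
  ext w
  simp [sub_neg]

/-- Boxes with endpoints in `K ⊆ ℚ̄ ∩ ℝ` are `ℚ`-semialgebraic. -/
theorem soloInformed_isSemialgebraic_boxK (hK : ∀ c : K, IsAlgebraic ℚ (algebraMap K ℝ c))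
    (lo hi : Fin 2 → K) : IsSemialgebraic ℚ (soloInformedBoxK lo hi) := by
  have h := ((soloInformed_isSemialgebraic_gt_coordK hK 0 (lo 0)).inter
    (soloInformed_isSemialgebraic_lt_coordK hK 0 (hi 0))).inter
    ((soloInformed_isSemialgebraic_gt_coordK hK 1 (lo 1)).inter
    (soloInformed_isSemialgebraic_lt_coordK hK 1 (hi 1)))
  convert h using 1
  ext w
  simp only [soloInformed_mem_boxK, Fin.forall_fin_two, mem_inter_iff, mem_setOf_eq]

/-! ### Splitting a grid cell at a special point -/

section Split

variable [CharZero K]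

/-- **Cell split at a special point.**  Let `p ∈ K²` lie in the grid cell `G`, and suppose
every point of `G ∖ {p}` in `closure Ω ∩ Z(F)` is a smooth point of `Z(F)` with `D ≠ 0`
(with the standing hypotheses of the global theorem).  Then `P/D` is presentable on `Ω ∩ G`:
`G` is the union of the four open boxes with vertex `p` and the opposite vertices of `G`
(some possibly empty) and a null set, and each box is decided by THEOREM QUADRANT.
[this work] -/
theorem soloInformed_presOn_inter_gridCell_of_special
    (hK : ∀ c : K, IsAlgebraic ℚ (algebraMap K ℝ c)) (hKrc : SoloInformedRealRootClosed K)
    {F D : MvPolynomial (Fin 2) K} {Ω : Set (Fin 2 → ℝ)} (hΩo : IsOpen Ω)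
    (hΩ : IsSemialgebraic ℚ Ω) (hfr : ∀ z ∈ frontier Ω, (MvPolynomial.aeval z F : ℝ) = 0)
    (hsing : (soloInformedSingSet F).Finite) (c : Fin 2 → K) {N : ℕ} (hN : 0 < N)
    (j : Fin 2 → Fin N) (hpG : (fun i => algebraMap K ℝ (c i)) ∈ soloInformedGridCell N j)
    (hgoodG : ∀ w ∈ soloInformedGridCell N j, w ≠ (fun i => algebraMap K ℝ (c i)) →
      w ∈ closure Ω → (MvPolynomial.aeval w F : ℝ) = 0 →
      ((MvPolynomial.aeval w (MvPolynomial.pderiv 0 F) : ℝ) ≠ 0 ∨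
        (MvPolynomial.aeval w (MvPolynomial.pderiv 1 F) : ℝ) ≠ 0) ∧
      (MvPolynomial.aeval w D : ℝ) ≠ 0)
    (P : MvPolynomial (Fin 2) K) :
    SoloInformedPresOn (Ω ∩ soloInformedGridCell N j)
      (fun z => (MvPolynomial.aeval z P : ℝ) / MvPolynomial.aeval z D) := by
  classical
  set p : Fin 2 → ℝ := fun i => algebraMap K ℝ (c i) with hp_def
  set f : (Fin 2 → ℝ) → ℝ := fun z => (MvPolynomial.aeval z P : ℝ) / MvPolynomial.aeval z D
  have hNr : (0 : ℝ) < N := by exact_mod_cast hN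
  -- the cell `G = [l₀, u₀] × [l₁, u₁]` with endpoints in `K`
  set lK : Fin 2 → K := fun i => ((j i : ℕ) : K) / N with hlK
  set uK : Fin 2 → K := fun i => (((j i : ℕ) : K) + 1) / N with huK
  have hl : ∀ i, algebraMap K ℝ (lK i) = ((j i : ℕ) : ℝ) / N := fun i => by
    simp [hlK, map_natCast]
  have hu : ∀ i, algebraMap K ℝ (uK i) = (((j i : ℕ) : ℝ) + 1) / N := fun i => by
    simp [huK, map_natCast]
  have hpG' := (soloInformed_mem_gridCell_iff.1 hpG)
  -- the four boxes
  set lo : (Fin 2 → Bool) → Fin 2 → K := fun σ i => if σ i then c i else lK i with hlo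
  set hi : (Fin 2 → Bool) → Fin 2 → K := fun σ i => if σ i then uK i else c i with hhi
  set B : (Fin 2 → Bool) → Set (Fin 2 → ℝ) := fun σ => soloInformedBoxK (lo σ) (hi σ) with hB
  have hBmem : ∀ σ w, w ∈ B σ ↔ ∀ i, (if σ i then p i < w i ∧ w i < (((j i : ℕ) : ℝ) + 1) / N
      else ((j i : ℕ) : ℝ) / N < w i ∧ w i < p i) := by
    intro σ w
    rw [hB, soloInformed_mem_boxK]
    refine forall_congr' fun i => ?_
    by_cases hσ : σ i
    · simp [hlo, hhi, hσ, hu, hp_def]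
    · simp [hlo, hhi, hσ, hl, hp_def]
  have hBG : ∀ σ, B σ ⊆ soloInformedGridCell N j := by
    intro σ w hw
    rw [hBmem] at hw
    refine soloInformed_mem_gridCell_iff.2 fun i => ?_
    have hwi := hw i
    by_cases hσ : σ i
    · rw [if_pos hσ] at hwi
      exact ⟨(hpG' i).1.trans hwi.1.le, hwi.2.le⟩
    · rw [if_neg hσ] at hwi
      exact ⟨hwi.1.le, hwi.2.le.trans (hpG' i).2⟩
  have hBsa : ∀ σ, IsSemialgebraic ℚ (Ω ∩ B σ) := fun σ =>
    hΩ.inter (soloInformed_isSemialgebraic_boxK hK _ _)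
  -- presentability on each box
  have hbox : ∀ σ, SoloInformedPresOn (Ω ∩ B σ) f := by
    intro σ
    -- chart data: vertex `p`, edge vector `b σ`
    set b : Fin 2 → K := fun i => (if σ i then uK i else lK i) - c i with hb
    by_cases hdeg : ∃ i, algebraMap K ℝ (b i) = 0
    · -- a degenerate box is empty
      obtain ⟨i, hi0⟩ := hdeg
      have hBe : Ω ∩ B σ = ∅ := by
        refine Set.eq_empty_of_forall_notMem fun w hw => ?_
        have hwi := (hBmem σ w).1 hw.2 i
        rw [hb] at hi0
        simp only [map_sub, sub_eq_zero] at hi0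
        by_cases hσ : σ i
        · rw [if_pos hσ] at hwi hi0
          rw [hu] at hi0
          have := hwi.1.trans hwi.2
          rw [hi0] at this
          exact lt_irrefl _ this
        · rw [if_neg hσ] at hwi hi0
          rw [hl] at hi0
          have := hwi.1.trans hwi.2
          rw [hi0] at this
          exact lt_irrefl _ this
      rw [hBe]
      exact soloInformed_presOn_empty f
    push Not at hdeg
    set Φ := soloInformedDiagMoveR (fun i => algebraMap K ℝ (c i)) (fun i => algebraMap K ℝ (b i))
      with hΦ
    have hβ : ∀ i, algebraMap K ℝ (b i) = (if σ i then (((j i : ℕ) : ℝ) + 1) / N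
        else ((j i : ℕ) : ℝ) / N) - p i := by
      intro i
      rw [hb]
      by_cases hσ : σ i
      · simp [hσ, hu, hp_def]
      · simp [hσ, hl, hp_def]
    -- the box is the image of the open square
    have hBimg : B σ = Φ '' soloInformedOpenCube 2 := by
      rw [hΦ, soloInformed_diagMoveR_image_openCube hdeg]
      ext w
      rw [hBmem, mem_setOf_eq]
      refine forall_congr' fun i => ?_
      rw [hβ i]
      by_cases hσ : σ i
      · rw [if_pos hσ, if_pos hσ]
        have hpos : 0 < (((j i : ℕ) : ℝ) + 1) / N - p i := by
          rcases (sub_nonneg.2 (hpG' i).2).eq_or_lt with h | h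
          · exact absurd (by rw [hβ i, if_pos hσ]; exact h.symm) (hdeg i)
          · exact h
        rw [div_pos_iff_of_pos_right hpos, div_lt_one hpos, sub_pos, sub_lt_sub_iff_right]
      · rw [if_neg hσ, if_neg hσ]
        have hneg : ((j i : ℕ) : ℝ) / N - p i < 0 := by
          rcases (sub_nonpos.2 (hpG' i).1).eq_or_lt with h | h
          · exact absurd (by rw [hβ i, if_neg hσ]; exact h) (hdeg i)
          · exact h
        constructor
        · rintro ⟨h1, h2⟩
          exact ⟨div_pos_of_neg_of_neg (sub_neg.2 h2) hneg,
            (div_lt_one_of_neg hneg).2 (by linarith)⟩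
        · rintro ⟨h1, h2⟩
          have h2' := (div_lt_one_of_neg hneg).1 h2
          have h1' : w i - p i < 0 := by
            rcases div_pos_iff.1 h1 with ⟨_, hb⟩ | ⟨ha, _⟩
            · exact absurd hb (not_lt.2 hneg.le)
            · exact ha
          constructor <;> linarith
    rw [hBimg]
    refine soloInformed_presOn_inter_quadrant hK hKrc hΩo hΩ hfr hsing c b hdeg ?_ P
    intro z hz hz0 hzcl hFz
    refine hgoodG _ ?_ ?_ hzcl hFz
    · -- `Φ z ∈ G`
      refine soloInformed_mem_gridCell_iff.2 fun i => ?_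
      rw [soloInformedDiagMoveR_apply, hβ i]
      have hz' := hz i
      by_cases hσ : σ i
      · rw [if_pos hσ]
        have hnn : 0 ≤ (((j i : ℕ) : ℝ) + 1) / N - p i := sub_nonneg.2 (hpG' i).2
        constructor
        · nlinarith [(hpG' i).1, mul_nonneg hnn hz'.1]
        · nlinarith [mul_le_of_le_one_right hnn hz'.2]
      · rw [if_neg hσ]
        have hnp : ((j i : ℕ) : ℝ) / N - p i ≤ 0 := sub_nonpos.2 (hpG' i).1
        constructor
        · nlinarith [mul_le_mul_of_nonpos_left hz'.2 hnp]
        · nlinarith [(hpG' i).2, mul_nonpos_of_nonpos_of_nonneg hnp hz'.1]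
    · -- `Φ z ≠ p`
      intro h
      apply hz0
      have h0 : Φ 0 = p := soloInformedDiagMoveR_zero _ _
      exact soloInformed_diagMoveR_injective hdeg (h.trans h0.symm)
  -- the union of the boxes fills `Ω ∩ G` up to a null set
  set Ω' : Set (Fin 2 → ℝ) := ⋃ σ, Ω ∩ B σ with hΩ'
  have hΩ'sa : IsSemialgebraic ℚ Ω' := by
    have : Ω' = ⋃ σ ∈ (Finset.univ : Finset (Fin 2 → Bool)), Ω ∩ B σ := by
      rw [hΩ']; simp only [Finset.mem_univ, iUnion_true]
    rw [this]
    exact IsSemialgebraic.biUnion _ _ fun σ _ => hBsa σ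
  have hΩ'sub : Ω' ⊆ Ω ∩ soloInformedGridCell N j := by
    rw [hΩ']
    exact iUnion_subset fun σ => inter_subset_inter_right _ (hBG σ)
  -- the exceptional lines
  set L : Set (Fin 2 → ℝ) := ({w | w 0 = p 0} ∪ {w | w 1 = p 1}) ∪
    (({w | w 0 = ((j 0 : ℕ) : ℝ) / N} ∪ {w | w 0 = (((j 0 : ℕ) : ℝ) + 1) / N}) ∪
      ({w | w 1 = ((j 1 : ℕ) : ℝ) / N} ∪ {w | w 1 = (((j 1 : ℕ) : ℝ) + 1) / N})) with hL
  have hdiff : (Ω ∩ soloInformedGridCell N j) \ Ω' ⊆ L := by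
    rintro w ⟨⟨hwΩ, hwG⟩, hwΩ'⟩
    by_contra hwL
    apply hwΩ'
    rw [hΩ', mem_iUnion]
    refine ⟨fun i => decide (p i < w i), hwΩ, (hBmem _ w).2 fun i => ?_⟩
    have hwG' := soloInformed_mem_gridCell_iff.1 hwG i
    have hne : w i ≠ p i ∧ w i ≠ ((j i : ℕ) : ℝ) / N ∧ w i ≠ (((j i : ℕ) : ℝ) + 1) / N := by
      fin_cases i
      · exact ⟨fun h => hwL (Or.inl (Or.inl h)), fun h => hwL (Or.inr (Or.inl (Or.inl h))),
          fun h => hwL (Or.inr (Or.inl (Or.inr h)))⟩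
      · exact ⟨fun h => hwL (Or.inl (Or.inr h)), fun h => hwL (Or.inr (Or.inr (Or.inl h))),
          fun h => hwL (Or.inr (Or.inr (Or.inr h)))⟩
    by_cases hlt : p i < w i
    · rw [decide_eq_true hlt, if_pos rfl]
      exact ⟨hlt, lt_of_le_of_ne hwG'.2 hne.2.2⟩
    · simp only [hlt, decide_false]
      exact ⟨lt_of_le_of_ne hwG'.1 (Ne.symm hne.2.1), lt_of_le_of_ne (not_lt.1 hlt) hne.1⟩
  have hline : ∀ (i : Fin 2) (t : ℝ), volume {w : Fin 2 → ℝ | w i = t} = 0 := fun i t => by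
    rw [MeasureTheory.volume_pi]
    exact Measure.pi_hyperplane _ _ _
  have hLnull : volume L = 0 := by
    rw [hL]
    exact measure_union_null (measure_union_null (hline 0 _) (hline 1 _)) (measure_union_null
      (measure_union_null (hline 0 _) (hline 0 _)) (measure_union_null (hline 1 _) (hline 1 _)))
  refine soloInformed_presOn_of_subset_null hΩ'sa hΩ'sub
    (measure_mono_null hdiff hLnull) ?_
  refine soloInformed_presOn_of_iUnion (fun σ => Ω ∩ B σ) hBsa (fun σ τ hστ => ?_) hΩ' hbox
  -- distinct boxes are disjoint
  obtain ⟨i, hi⟩ := Function.ne_iff.1 hστ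
  have hempty : (Ω ∩ B σ) ∩ (Ω ∩ B τ) = ∅ := by
    refine Set.eq_empty_of_forall_notMem fun w hw => ?_
    have h1 := (hBmem σ w).1 hw.1.2 i
    have h2 := (hBmem τ w).1 hw.2.2 i
    by_cases hσ : σ i
    · have hτ : τ i = false := by
        cases h : τ i
        · rfl
        · exact absurd (hσ.trans h.symm) hi
      rw [if_pos hσ] at h1
      rw [hτ] at h2
      simp only [Bool.false_eq_true, ↓reduceIte] at h2
      exact lt_irrefl _ (h1.1.trans h2.2)
    · have hτ : τ i = true := by
        cases h : τ i
        · exact absurd ((Bool.eq_false_iff.2 hσ).trans h.symm) hi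
        · rfl
      rw [if_neg hσ] at h1
      rw [hτ, if_pos rfl] at h2
      exact lt_irrefl _ (h2.1.trans h1.2)
  rw [hempty, measure_empty]

end Split

/-! ### GLOBAL THEOREM -/

section Global

variable [CharZero K]

/-- Local presentability at a special point: a small grid cell near `p ∈ Σ` either contains
`p` (cell split, THEOREM QUADRANT) or misses `Σ` (THEOREM LEAF). [this work] -/
theorem soloInformed_locPresOn_of_mem_specialSet
    (hK : ∀ c : K, IsAlgebraic ℚ (algebraMap K ℝ c)) (hKrc : SoloInformedRealRootClosed K)
    {F D : MvPolynomial (Fin 2) K} {Ω : Set (Fin 2 → ℝ)} (hΩo : IsOpen Ω)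
    (hΩ : IsSemialgebraic ℚ Ω) (hfr : ∀ z ∈ frontier Ω, (MvPolynomial.aeval z F : ℝ) = 0)
    (hsing : (soloInformedSingSet F).Finite) (hSig : (soloInformedSpecialSet F D Ω).Finite)
    {p : Fin 2 → ℝ} (hp : p ∈ soloInformedSpecialSet F D Ω) (P : MvPolynomial (Fin 2) K) :
    SoloInformedLocPresOn Ω (fun z => (MvPolynomial.aeval z P : ℝ) / MvPolynomial.aeval z D) p := by
  obtain ⟨c, hc⟩ := soloInformed_exists_coordsK_of_mem_specialSet hK hKrc hΩ hSig hp
  subst hc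
  have hfin : (soloInformedSpecialSet F D Ω \ {fun i => algebraMap K ℝ (c i)}).Finite :=
    hSig.subset Set.sdiff_subset
  obtain ⟨ε, hε, hball⟩ := Metric.isOpen_iff.1 hfin.isClosed.isOpen_compl _ fun h => h.2 rfl
  refine ⟨ε, hε, fun N j hN hG => ?_⟩
  have hgoodG : ∀ w ∈ soloInformedGridCell N j, w ≠ (fun i => algebraMap K ℝ (c i)) →
      w ∈ closure Ω → (MvPolynomial.aeval w F : ℝ) = 0 →
      ((MvPolynomial.aeval w (MvPolynomial.pderiv 0 F) : ℝ) ≠ 0 ∨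
        (MvPolynomial.aeval w (MvPolynomial.pderiv 1 F) : ℝ) ≠ 0) ∧
      (MvPolynomial.aeval w D : ℝ) ≠ 0 := by
    intro w hw hne hcl hF
    exact soloInformed_good_of_not_mem_specialSet (fun hwS => hball (hG hw) ⟨hwS, hne⟩) hcl hF
  by_cases hpG : (fun i => algebraMap K ℝ (c i)) ∈ soloInformedGridCell N j
  · exact soloInformed_presOn_inter_gridCell_of_special hK hKrc hΩo hΩ hfr hsing c hN j hpG
      hgoodG P
  · exact soloInformed_presOn_inter_gridCell_of_leafCfg hK hKrc P D F hΩo hΩ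
      (fun z _ hz => hfr z hz) hN j fun z hz hcl hF =>
        hgoodG z hz (fun h => hpG (h ▸ hz)) hcl hF

/-- **GLOBAL THEOREM.**  Let `K ⊆ ℚ̄ ∩ ℝ` be real-root closed, `Ω ⊆ [0,1]²` open and
`ℚ`-semialgebraic, `F, D ∈ K[x, y]` with `frontier Ω ⊆ Z(F)`, `Sing F` finite and the special
set `Σ(F, D, Ω)` finite.  Then `P/D` is presentable on `Ω` for every `P ∈ K[x, y]`: local
presentability holds at every point of the square (THEOREM LEAF off `Σ`, the cell split at
points of `Σ`), and presentability is local (THEOREM LOC). [this work] -/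
theorem soloInformed_presOn_global
    (hK : ∀ c : K, IsAlgebraic ℚ (algebraMap K ℝ c)) (hKrc : SoloInformedRealRootClosed K)
    {F D : MvPolynomial (Fin 2) K} {Ω : Set (Fin 2 → ℝ)} (hΩo : IsOpen Ω)
    (hΩ : IsSemialgebraic ℚ Ω) (hΩc : Ω ⊆ soloInformedCube 2)
    (hfr : ∀ z ∈ frontier Ω, (MvPolynomial.aeval z F : ℝ) = 0)
    (hsing : (soloInformedSingSet F).Finite) (hSig : (soloInformedSpecialSet F D Ω).Finite)
    (P : MvPolynomial (Fin 2) K) :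
    SoloInformedPresOn Ω (fun z => (MvPolynomial.aeval z P : ℝ) / MvPolynomial.aeval z D) := by
  refine soloInformed_presOn_of_locally hΩ hΩc fun p _ => ?_
  by_cases hpS : p ∈ soloInformedSpecialSet F D Ω
  · exact soloInformed_locPresOn_of_mem_specialSet hK hKrc hΩo hΩ hfr hsing hSig hpS P
  · obtain ⟨ε, hε, hball⟩ := Metric.isOpen_iff.1 hSig.isClosed.isOpen_compl p hpS
    refine ⟨ε, hε, fun N j hN hG => ?_⟩
    exact soloInformed_presOn_inter_gridCell_of_leafCfg hK hKrc P D F hΩo hΩ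
      (fun z _ hz => hfr z hz) hN j fun z hz hcl hF =>
        soloInformed_good_of_not_mem_specialSet (hball (hG hz)) hcl hF

end Global

end Summit.KontsevichZagierPeriods.KontsevichZagierPeriods.Theorems
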